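import Mathlib
import HarnessLib
import HarnessLib.Audit
import Summits.SmoothPoincare4.Statement
import Literature.Topology.FourManifolds.SurgeredMappingTorusAt
import Literature.Topology.FourManifolds.MappingTorus
import Literature.Geometry.Lorentzian.LeviCivita
import Literature.Geometry.Riemannian.ConstantCurvature
import HarnessLib.Audit.Status.Attr

/-!
Route: FibredPageGeometrization

# Route FibredPageGeometrization — SPC4 on the fibred class, split by the geometry of the closed
page

It suffices to show X = E ∧ G (card fibred-page-geometrization). A homotopy 4-sphere Σ is in the
FIBRED CLASS when it is a surgered
mapping torus `IsSurgeredMappingTorusAt φ x₀ Σ`: the closed smooth mapping torus of a diffeomorphism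
φ of a closed 3-manifold F (the
closed PAGE, charted on ℝ³) fixing x₀, surgered along the section circle through x₀ with either
framing (Gompf's X_φ^ε for a general
page; = Σ has an open book with binding S², i.e. contains a fibred 2-knot, or is the Gluck twist of
such). E = `FibredKnotExists`
(RESIDUAL, imported, S-implied: every homotopy 4-sphere is in the fibred class). G = SPC4 ON THE
FIBRED CLASS, attacked as three ranked
cruxes indexed by the geometry of the page: `HyperbolicPageStandard` (F carries a hyperbolic
metric), `SeifertSolPageStandard` (F is
finitely covered by a 3-manifold with a free smooth circle action or by a T²-bundle over S¹ —
Seifert ∪ Sol, incl. S³ and T³ = the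
Cappell–Shaneson case), `CompositePageReduction` (given those two, the remaining pages). E ∧ G ⟺
SPC4; the split is propositional.
Lean: `FibredKnotExists ∧ HyperbolicPageStandard ∧ SeifertSolPageStandard ∧ CompositePageReduction`

## Assembly
Pure logic (proved sorry-free in the planner's Sketch.lean, 10 lines, and in glue.lean): unfold
`SmoothPoincare4` to its binders
(M, T2, second countable, C^∞ atlas on ℝ⁴, e : M ≃ₕ S⁴); FibredKnotExists gives (F, φ, x₀) with
`IsSurgeredMappingTorusAt φ x₀ M`;
`by_cases` on the hyperbolic-metric hypothesis of HyperbolicPageStandard, then on the covering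
hypothesis of SeifertSolPageStandard,
else CompositePageReduction applied to the two previous cruxes and the two negations. No
geometrisation fact is needed in the glue: the
third case is literally the complement. The deciding theorem is `closes (hA : Assembly) (h₁ :
FibredKnotExists) (h₂ : HyperbolicPageStandard)
(h₃ : SeifertSolPageStandard) (h₄ : CompositePageReduction) : SmoothPoincare4 := hA h₁ h₂ h₃ h₄`,
and `Assembly` itself is provable now
(`assembly_holds`, to be landed in Theorems right after birth).

Rationale: WHY THIS LINE. Every known candidate exotic 4-sphere that has been standardised by hand
(Cappell–Shaneson spheres, Gluck twists of twist- /roll-spun and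
branched-twist-spun knots, Plotnick's gluings P ∪ X×S¹) is a surgered mapping torus of a 3-manifold
diffeomorphism [GompfAGT2010 §2,
AitchisonRubinstein1984 §2 + p.33, Plotnick1984, Hillman1989 Ch. 2 p.12], and the standardisation
always ran through the PAGE: for a
hyperbolic page Mostow rigidity + Gabai–Meyerhoff–Thurston [Mostow1968, GabaiMeyerhoffThurston2003]
make the closed monodromy isotopic to a
periodic isometry ψ, so Σ is surgery on a section of the Seifert-fibred 4-manifold M_ψ, and when the
section is a ψ-orbit Σ carries a smooth
circle action and is S⁴ by Fintushel–Pao [Fintushel1977, Pao1978, Plotnick1986, Fukuda2018] (engine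
= barrier A9 used positively; reuse
`CyclicSymmetryRung.FintushelPao` by name); for Seifert pages Meeks–Scott [MeeksScott1986] makes φ
fibre-preserving, for T³/Sol pages
Gompf's handle moves [GompfAGT2010] are the engine; composite pages reduce by the equivariant
sphere/JSJ theorems. Imported: 3-manifold
geometrisation and mapping-class rigidity (hyperbolic geometry), transformation groups (circle
actions). In the hub this is the line of the
unrouted idea card geometrise-the-page (2026-08-15, audited `variant`: Plotnick 1984 posed the
rolling residue, Hillman GTM5 p.129/217 prints the
Mostow step), re-derived independently by the blind mwave sketch fibred-page-geometrization; this
route is its typed, crux-first filing. No SP4 ROUTE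
restricts SPC4 to the fibred/open-book class or indexes by page geometry (HyperbolicTorusFillings:
torus-link fillings; CyclicSymmetryRung /
QuotientSpheres: finite symmetry assumed; closed CsArithmeticWalk = the T³ sub-rung only); negatives
index empty at filing.

RANKED CRUXES. #2 HyperbolicPageStandard (crux) — K2 of the card. For every closed 3-manifold page F
charted on ℝ³ admitting a Riemannian metric with a Levi-Civita connection of constant sectional
curvature −1, every diffeomorphism φ of F, base point x₀ and smooth 4-manifold X: if X is a surgered
mapping torus of φ at x₀ and X ≃ S⁴ then X is diffeomorphic to S⁴. [difficulty: L] (why it might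
fail: Mostow–GMT make the CLOSED monodromy isotopic to a periodic ψ, but the section circle need not
be isotopic to a ψ-orbit (Hillman 1989 p.65: finite-order closed monodromy does not give periodic
exterior monodromy), so no circle action on X; that residual section class is a genuine Gluck-type
problem.) [Mostow1968, GabaiMeyerhoffThurston2003, Hillman1989, Plotnick1986, Pao1978, Fukuda2018,
Gordon1976]
#3 SeifertSolPageStandard (crux) — K3 of the card. Same conclusion for pages F finitely covered
(smooth covering map from a compact 3-manifold F') by an F' carrying a free smooth circle action or
by an F' that is a smooth mapping torus of a diffeomorphism of the 2-torus Circle × Circle (Seifert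
fibred ∪ Sol pages, incl. S³, lens spaces, T³ = Cappell–Shaneson). [difficulty: L] (why it might
fail: the Seifert case needs φ isotopic to a fibre-preserving map (Meeks–Scott) AND the section an
orbit of the induced circle action on M_φ; the T²-bundle/T³ pages contain every Cappell–Shaneson
sphere, standard only in Gompf's classes (CappellShanesonSpheresStandard is registered OPEN).)
[Scott1983, MeeksScott1986, Fintushel1977, Pao1978, Plotnick1984, GompfAGT2010, AkbulutKirby1985]
#4 CompositePageReduction (crux) — K4 of the card (the reduction): HyperbolicPageStandard →
SeifertSolPageStandard → the same conclusion for every page F in NEITHER class (by geometrisation: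
the reducible pages and the prime pages with non-trivial JSJ decomposition) — an equivariant
prime/JSJ normal form of φ and a re-assembly of X from surgered mapping tori of the geometric
pieces. [deps: HyperbolicPageStandard, SeifertSolPageStandard] [difficulty: XL] (why it might fail:
φ has an equivariant sphere/JSJ normal form (Meeks–Scott), but surgery on ONE section circle does
not visibly split X into homotopy-sphere pieces indexed by the summands (Hillman 1989 p.67: isotopy
rel a cell is the obstacle); cusped hyperbolic JSJ pieces lack K2's closed-page rigidity.)
[MeeksScott1986, Hillman1989, Scott1983, Perelman2002, Perelman2003a]
#5 FibredKnotExists (crux) — K1 of the card — RESIDUAL conjunct (imported, not attacked; S-implied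
since S⁴ = surgery on pt × S¹ ⊂ S³ × S¹): every smooth homotopy 4-sphere X is a surgered mapping
torus of some based diffeomorphism (F, φ, x₀) of a closed 3-manifold, i.e. contains a fibred 2-knot
(open book with binding S²) or is a Gluck twist of such. [difficulty: open-problem] (why it might
fail: only SPC4 ⇒ E is known; open-book existence theorems (Winkelnkemper, Lawson, Quinn) start in
dimension ≥ 5 and give uncontrolled binding, Aitchison–Rubinstein 1984 p.33 leave exactly this open;
an exotic Σ with no fibred 2-knot refutes E without touching G — E is plausibly false off S⁴.)
[AitchisonRubinstein1984, GompfStipsicz1999, Hillman1989]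

TWO-LAYER PLAN. HyperbolicPageStandard ⇐ MostowPeriodicRepresentative (φ isotopic rel x₀-orbit data
to a periodic isometry ψ; Mostow + GMT) →
OrbitSectionStandard (section isotopic to a closed ψ-orbit ⇒ X has an effective smooth circle action
⇒ X ≅ S⁴ by FintushelPao; both
framings by Pao/Fukuda) → SectionClassNormalisation (every section class of M_ψ on which surgery
gives a homotopy sphere is an orbit
class, or its Gluck pair is standard) → HyperbolicPageStandard. SeifertSolPageStandard ⇐
SeifertPageStandard (fibre-preserving φ,
Meeks–Scott; circle action on M_φ) + TorusBundlePageStandard (T³ = Cappell–Shaneson via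
Gompf-equivalence
`nonempty_diffeomorph_sphere_four_of_isCappellShanesonSphereOf` on Gompf's classes; Sol monodromies)
→ SeifertSolPageStandard.
CompositePageReduction ⇐ EquivariantNormalForm (φ preserves a prime/JSJ system up to isotopy rel x₀)
+ SpliceReassembly. Nothing filed now.

KILL CRITERIA. Every kill is an exotic S⁴ (SPC4-shielding, BARRIERS §D.1): ¬HyperbolicPageStandard /
¬SeifertSolPageStandard / ¬CompositePageReduction
exhibit an exotic sphere IN the fibred class (route closed `refuted:<Decl>`, summit decided
negatively); ¬FibredKnotExists exhibits a
homotopy sphere with no fibred 2-knot, which is exotic since S⁴ has one — the route then survives as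
the FRONTIER theorem "SPC4 on the
fibred class" but is closed as a summit route (`refuted:FibredKnotExists`). A proof elsewhere of
SPC4 moots everything; a proof of
CappellShanesonSpheresStandard closes the T³ sub-rung of SeifertSolPageStandard only.

NOT DECOMPOSED YET. The section-class analysis inside HyperbolicPageStandard (orbit vs non-orbit
sections of M_ψ; the two Gluck framings), the Seifert /
T²-bundle halves of SeifertSolPageStandard, the S³ page (Cerf–Hatcher: φ isotopic to id rel x₀ ⇒ X ∈
{S⁴, Gluck twist of the unknot}), and
the normal-form / splice lemmas of CompositePageReduction are layer-2 children, filed by glued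
splits once a crux moves. Named facts the
provers will want vendored (cite items, not filed now): Mostow–GMT `Diff(F) ≃ Isom(F)` for closed
hyperbolic F; Meeks–Scott 1986 Thm 2.1;
Hatcher's Smale conjecture; Perelman geometrisation (only CompositePageReduction's informal reading
uses it).

CHEAPEST FALSIFIER. Statement side: none cheaper than an exotic S⁴ (every crux has the shielded
shape `… → X ≃ₕ S⁴ → X ≅ S⁴` or is S-implied existence).
Line side (kills the PLAN of the deciding crux, not the crux): a fibred 2-knot in S⁴ with HYPERBOLIC
closed fibre whose exterior
monodromy is not periodic although the closed monodromy has finite order in Out(π₁F) (Hillman 1989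
p.65 warns this happens in general
but names no hyperbolic example; Plotnick 1986) — one literature lookup / one explicit section of
M_ψ for ψ the deck involution of a
hyperbolic 2-bridge knot's 3-fold cover. Typing side (run by the planner): `lean check Sketch.lean`
rc 0, 0 sorries; BC2/BC7 probes below.

NUMBERS. Plotnick 1984 (Contemp. Math. 35, p.437): "roughly two-thirds" of the homotopy spheres P
∪_A T³×S¹ … are shown smoothly S⁴ (Cor. 2.7) —
the measured reach of the circle-action engine on the T³-page family; Gompf 2010 Thm 3.2:
Cappell–Shaneson matrices in standard form with
|d| < 17 (and the family A_m, both framings: Akbulut 2010, Gompf 2010) are standard; Gluck twists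
standard for: twist spins (Gordon 1976),
branched twist spins K^{m,n} (Pao 1978, Fukuda 2018: Σ(K^{m,n}) ≅ S⁴ with new knot K^{m,n+m}),
twist-roll spins of unknotting-number-one
knots (Naylor–Schwartz 2022).

DEFINITION REQUESTS. Filed with this route: Literature T0 predicate
`Literature.Topology.FourManifolds.IsSurgeredMappingTorusAt` (proposal p171866,
Literature/Topology/FourManifolds/SurgeredMappingTorusAt.lean: the body of the accepted
`IsSurgeredMappingTorusOf` with a general page and
base point; Gompf 2010 §2). Wanted later as cite facts (not filed now):
`mostowGMT_diffeomorph_isotopic_periodic_isometry`,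
`meeksScott_fibrePreserving_representative`, `hatcher_smaleConjecture_diff_rel_point`.

Novelty: Searches (2026-08-17): lit search "fibered knot homotopy 4-sphere open book" / "Aitchison Rubinstein
fibered" (corpus fts: book:gordon1984-four-manifold-theory pp. 7–10, 33, 389–411); lit search
--source all "Gluck twist branched twist spin standard 4-sphere" (1 held: paper:arxiv-2304.06276;
remote APIs rate-limited); lit vsearch "Gluck twist on a fibered 2-knot whose monodromy has finite
order … circle actions" (10 docs: gordon1984 pp. 403–409, kirby1989 pp. 14/37/88, juhasz2023); lit
galaxy search "fibered 2-knot|fibred 2-knot|open book decomposition with binding" --star all (9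
rows: [galaxy:panama:427057188175931] Hillman, 2-Knots and Their Groups;
[galaxy:panama:246342144229421] Gordon–Kirby (eds.) Four-Manifold Theory; [galaxy:pdf:5293463420]
Colin–Ghiggini–Honda, irrelevant); lit galaxy search --in-book 427057188175931 "finite order|twist
spin|Gluck"; lit read arxiv:1811.05109 (Fukuda); lit frontier SmoothPoincare4 --since 2020 and lit
bridges --cross any ([graph]: 30 + 30 rows, all Ricci-flow / survey, no fibred-knot descendant);
ledger negatives --problem SmoothPoincare4 (0); ledger route ls (26 SP4 routes: none on open books /
fibred 2-knots).
Nearest prior art found: IN HUB — idea card geometrise-the-page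
(Summits/SmoothPoincare4/SmoothPoincare4/Ideas/geometrise-the-page.md; same mechanism: Mostow–Gabai
rigidity of a hyperbolic page ⇒ periodic monodromy up to one drag ⇒ circle action ⇒ Fintushel–Pao,
torus-bundle pages = CS residue, OB = open-book existence as the g  [refs: 1811.05109, math/0212142, book:gordon1984-four-manifold-theory, paper:arxiv-2304.06276, arxiv:1811.05109, Plotnick1984, NaylorSchwartz2022, Plotnick1986, AitchisonRubinstein1984, Hillman1989, Pao1978, Fintushel1977, Fukuda2018, GompfAGT2010]

Barriers (technique_class: open-book, page-geometrisation, mapping-class-rigidity): - technique_class: open-book, page-geometrisation, mapping-class-rigidity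
- CONJUNCT SPLIT (T1′; machine line): attacked=HyperbolicPageStandard (rank 2, deciding; with
SeifertSolPageStandard rank 3 and CompositePageReduction rank 4);
residual=Summit.SmoothPoincare4.SmoothPoincare4.Theses.FibredPageGeometrization.FibredKnotExists
(rank 5, imported existence conjunct, NOT to be staffed before the attacked cruxes);
joint_equivalence=(FibredKnotExists ∧ HyperbolicPageStandard ∧ SeifertSolPageStandard ∧
CompositePageReduction) ↔ SmoothPoincare4 — "→" is `assembly_holds` (Sketch.lean, sorry-free), "←"
is S ⇒ each crux (the three attacked cruxes end in `X ≃ₕ S⁴ → X ≅ S⁴`; S ⇒ FibredKnotExists via S⁴ =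
(S³ × S¹ surgered along pt × S¹) and diffeomorphism invariance, [GompfStipsicz1999 §5.2], not
landed); tribunal runs MUST pass `--residual FibredKnotExists`.
- Literature.Barriers.SmoothPoincare4.CircleActionBarrierFour: INSIDE by design for the
orbit-section sub-case of HyperbolicPageStandard / SeifertSolPageStandard — the barrier's named fact
`fintushelPao_circleAction_homotopySphere_four` (route decl `CyclicSymmetryRung.FintushelPao`) is
the ENGINE, used positively; the content of the cruxes is what is OUTSIDE it: sections that are not
orbits (no circle action on X) — there the bet is mapping-class rigidity of the page + Gluck-pair
analysis (Pao/Fukuda), not symmetry.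
- Literature.Barriers.SmoothPoincare4.CappellShanesonFamilyBarrier: the T³ page of
SeifertSolPageStandard contains e

sub-problem: SmoothPoincare4 · status: open · opened planner-type-7fdb6c1e92-0 2026-08-17T19:03:45Z · rev 0 · ledger route-SmoothPoincare4-FibredPageGeometrization
GENERATED by the gate from the ledger (D-0016/17). Provers cite these decls: `theorem foo : Summit.SmoothPoincare4.SmoothPoincare4.Theses.FibredPageGeometrization.<Decl> := …` in Summits/SmoothPoincare4/SmoothPoincare4/Theorems/<Name>.lean.
-/

namespace Summit.SmoothPoincare4.SmoothPoincare4.Theses.FibredPageGeometrization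

open scoped BigOperators Topology Manifold Classical MeasureTheory ProbabilityTheory Matrix InnerProductSpace ComplexConjugate ContinuousMap
open Filter Set Function TopologicalSpace MeasureTheory

attribute [summit_statement] _root_.SmoothPoincare4

open Literature.SPC4

/-- item stmt-SmoothPoincare4-19960 · crux · rank 2 · open · by planner
why it might fail: Mostow–GMT make the CLOSED monodromy isotopic to a periodic ψ, but the section circle need not be isotopic to a ψ-orbit (Hillman 1989 p.65: finite-order closed monodromy does not give periodic exterior monodromy), so no circle action on X; that residual section class is a genuine Gluck-type problem.
sources: Mostow1968, GabaiMeyerhoffThurston2003, Hillman1989, Plotnick1986, Pao1978, Fukuda2018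
[crux] K2 of the card. For every closed 3-manifold page F charted on ℝ³ admitting a Riemannian
metric with a Levi-Civita connection of constant sectional curvature −1, every diffeomorphism φ of
F, base point x₀ and smooth 4-manifold X: if X is a surgered mapping torus of φ at x₀ and X ≃ S⁴
then X is diffeomorphic to S⁴. [difficulty: L] -/
@[route_item "route-SmoothPoincare4-FibredPageGeometrization", crux]
def HyperbolicPageStandard : Prop :=
  open scoped ContDiff in ∀ (F : Type) [TopologicalSpace F] [T2Space F] [SecondCountableTopology F] [CompactSpace F] [ChartedSpace (EuclideanSpace ℝ (Fin 3)) F] [IsManifold (𝓡 3) ∞ F] (φ : F ≃ₘ⟮𝓡 3, 𝓡 3⟯ F) (x₀ : F) (X : Type) [TopologicalSpace X] [T2Space X] [SecondCountableTopology X] [ChartedSpace (EuclideanSpace ℝ (Fin 4)) X] [IsManifold (𝓡 4) ∞ X], (∃ (g : Literature.Geometry.Lorentzian.PseudoRiemannianMetric (𝓡 3) ∞ (EuclideanSpace ℝ (Fin 3)) (TangentSpace (𝓡 3) : F → Type _)) (cov : CovariantDerivative (𝓡 3) (EuclideanSpace ℝ (Fin 3)) (TangentSpace (𝓡 3) : F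 → Type _)), g.IsRiemannian ∧ g.IsLeviCivita cov ∧ g.HasConstantSectionalCurvatureWith cov (-1)) → Literature.Topology.FourManifolds.IsSurgeredMappingTorusAt φ x₀ X → Nonempty (X ≃ₕ (Metric.sphere (0 : EuclideanSpace ℝ (Fin 5)) 1)) → Nonempty (X ≃ₘ⟮𝓡 4, 𝓡 4⟯ (Metric.sphere (0 : EuclideanSpace ℝ (Fin 5)) 1))

/-- item stmt-SmoothPoincare4-19961 · crux · rank 3 · open · by planner
why it might fail: the Seifert case needs φ isotopic to a fibre-preserving map (Meeks–Scott) AND the section an orbit of the induced circle action on M_φ; the T²-bundle/T³ pages contain every Cappell–Shaneson sphere, standard only in Gompf's classes (CappellShanesonSpheresStandard is registered OPEN).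
sources: Scott1983, MeeksScott1986, Fintushel1977, Pao1978, Plotnick1984, GompfAGT2010
[crux] K3 of the card. Same conclusion for pages F finitely covered (smooth covering map from a
compact 3-manifold F') by an F' carrying a free smooth circle action or by an F' that is a smooth
mapping torus of a diffeomorphism of the 2-torus Circle × Circle (Seifert fibred ∪ Sol pages, incl.
S³, lens spaces, T³ = Cappell–Shaneson). [difficulty: L] -/
@[route_item "route-SmoothPoincare4-FibredPageGeometrization", crux]
def SeifertSolPageStandard : Prop :=
  open scoped ContDiff in ∀ (F : Type) [TopologicalSpace F] [T2Space F] [SecondCountableTopology F] [CompactSpace F] [ChartedSpace (EuclideanSpace ℝ (Fin 3)) F] [IsManifold (𝓡 3) ∞ F] (φ : F ≃ₘ⟮𝓡 3, 𝓡 3⟯ F) (x₀ : F) (X : Type) [TopologicalSpace X] [T2Space X] [SecondCountableTopology X] [ChartedSpace (EuclideanSpace ℝ (Fin 4)) X] [IsManifold (𝓡 4) ∞ X], (∃ (F' : Type) (_ : TopologicalSpace F') (_ : T2Space F') (_ : SecondCountableTopology F') (_ : CompactSpace F') (_ : ChartedSpace (EuclideanSpace ℝ (Fin 3)) F') (_ :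 IsManifold (𝓡 3) ∞ F') (p : F' → F), IsCoveringMap p ∧ ContMDiff (𝓡 3) (𝓡 3) ∞ p ∧ ((∃ (_ : MulAction Circle F'), ContMDiffSMul (𝓡 1) (𝓡 3) ∞ Circle F' ∧ ∀ (z : Circle) (y : F'), z • y = y → z = 1) ∨ (∃ ψ : (Circle × Circle) ≃ₘ⟮(𝓡 1).prod (𝓡 1), (𝓡 1).prod (𝓡 1)⟯ (Circle × Circle), Literature.Topology.FourManifolds.IsMappingTorusOf (𝓡 3) F' ψ))) → Literature.Topology.FourManifolds.IsSurgeredMappingTorusAt φ x₀ X → Nonempty (X ≃ₕ (Metric.sphere (0 : EuclideanSpace ℝ (Fin 5)) 1)) → Nonempty (X ≃ₘ⟮𝓡 4, 𝓡 4⟯ (Metric.sphere (0 : EuclideanSpace ℝ (Fin 5)) 1))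

/-- item stmt-SmoothPoincare4-19962 · crux · rank 4 · open · by planner
why it might fail: φ has an equivariant sphere/JSJ normal form (Meeks–Scott), but surgery on ONE section circle does not visibly split X into homotopy-sphere pieces indexed by the summands (Hillman 1989 p.67: isotopy rel a cell is the obstacle); cusped hyperbolic JSJ pieces lack K2's closed-page rigidity.
sources: MeeksScott1986, Hillman1989, Scott1983, Perelman2002, Perelman2003a
[crux] K4 of the card (the reduction): HyperbolicPageStandard → SeifertSolPageStandard → the same
conclusion for every page F in NEITHER class (by geometrisation: the reducible pages and the prime
pages with non-trivial JSJ decomposition) — an equivariant prime/JSJ normal form of φ and a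
re-assembly of X from surgered mapping tori of the geometric pieces. [deps: HyperbolicPageStandard,
SeifertSolPageStandard] [difficulty: XL] -/
@[route_item "route-SmoothPoincare4-FibredPageGeometrization", crux]
def CompositePageReduction : Prop :=
  open scoped ContDiff in HyperbolicPageStandard → SeifertSolPageStandard → ∀ (F : Type) [TopologicalSpace F] [T2Space F] [SecondCountableTopology F] [CompactSpace F] [ChartedSpace (EuclideanSpace ℝ (Fin 3)) F] [IsManifold (𝓡 3) ∞ F] (φ : F ≃ₘ⟮𝓡 3, 𝓡 3⟯ F) (x₀ : F) (X : Type) [TopologicalSpace X] [T2Space X] [SecondCountableTopology X] [ChartedSpace (EuclideanSpace ℝ (Fin 4)) X] [IsManifold (𝓡 4) ∞ X], ¬ (∃ (g : Literature.Geometry.Lorentzian.PseudoRiemannianMetric (𝓡 3) ∞ (EuclideanSpace ℝ (Fin 3)) (TangentSpace (𝓡 3) : F → Type _)) (cov : CovariantDerivative (𝓡 3) (EuclideanSpace ℝ (Fin 3)) (TangentSpace (𝓡 3) : F → Type _)), g.IsRiemannian ∧ g.IsLeviCivita cov ∧ g.HasConstantSectionalCurvatureWith cov (-1)) → ¬ (∃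 (F' : Type) (_ : TopologicalSpace F') (_ : T2Space F') (_ : SecondCountableTopology F') (_ : CompactSpace F') (_ : ChartedSpace (EuclideanSpace ℝ (Fin 3)) F') (_ : IsManifold (𝓡 3) ∞ F') (p : F' → F), IsCoveringMap p ∧ ContMDiff (𝓡 3) (𝓡 3) ∞ p ∧ ((∃ (_ : MulAction Circle F'), ContMDiffSMul (𝓡 1) (𝓡 3) ∞ Circle F' ∧ ∀ (z : Circle) (y : F'), z • y = y → z = 1) ∨ (∃ ψ : (Circle × Circle) ≃ₘ⟮(𝓡 1).prod (𝓡 1), (𝓡 1).prod (𝓡 1)⟯ (Circle × Circle), Literature.Topology.FourManifolds.IsMappingTorusOf (𝓡 3) F' ψ))) → Literature.Topology.FourManifolds.IsSurgeredMappingTorusAt φ x₀ X → Nonempty (X ≃ₕ (Metric.sphere (0 : EuclideanSpace ℝ (Fin 5)) 1)) → Nonempty (X ≃ₘ⟮𝓡 4, 𝓡 4⟯ (Metric.sphere (0 : EuclideanSpace ℝ (Fin 5)) 1))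

/-- item stmt-SmoothPoincare4-19963 · crux · rank 5 · open · by planner
why it might fail: only SPC4 ⇒ E is known; open-book existence theorems (Winkelnkemper, Lawson, Quinn) start in dimension ≥ 5 and give uncontrolled binding, Aitchison–Rubinstein 1984 p.33 leave exactly this open; an exotic Σ with no fibred 2-knot refutes E without touching G — E is plausibly false off S⁴.
sources: AitchisonRubinstein1984, GompfStipsicz1999, Hillman1989
[crux] K1 of the card — RESIDUAL conjunct (imported, not attacked; S-implied since S⁴ = surgery on
pt × S¹ ⊂ S³ × S¹): every smooth homotopy 4-sphere X is a surgered mapping torus of some based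
diffeomorphism (F, φ, x₀) of a closed 3-manifold, i.e. contains a fibred 2-knot (open book with
binding S²) or is a Gluck twist of such. [difficulty: open-problem] -/
@[route_item "route-SmoothPoincare4-FibredPageGeometrization", crux]
def FibredKnotExists : Prop :=
  open scoped ContDiff in ∀ (X : Type) [TopologicalSpace X] [T2Space X] [SecondCountableTopology X] [ChartedSpace (EuclideanSpace ℝ (Fin 4)) X] [IsManifold (𝓡 4) ∞ X], Nonempty (X ≃ₕ (Metric.sphere (0 : EuclideanSpace ℝ (Fin 5)) 1)) → ∃ (F : Type) (_ : TopologicalSpace F) (_ : T2Space F) (_ : SecondCountableTopology F) (_ : CompactSpace F) (_ : ChartedSpace (EuclideanSpace ℝ (Fin 3)) F) (_ : IsManifold (𝓡 3) ∞ F) (φ : F ≃ₘ⟮𝓡 3, 𝓡 3⟯ F) (x₀ : F), Literature.Topology.FourManifolds.IsSurgeredMappingTorusAt φ x₀ X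

/-- item stmt-SmoothPoincare4-19964 · assembly · rank 1 · open · by planner
sources: GompfAGT2010, AitchisonRubinstein1984
[assembly] FibredKnotExists → HyperbolicPageStandard → SeifertSolPageStandard →
CompositePageReduction → SmoothPoincare4 (pure logic; proved in Sketch.lean as `assembly_holds`). -/
@[route_item "route-SmoothPoincare4-FibredPageGeometrization", crux]
def Assembly : Prop :=
  FibredKnotExists → HyperbolicPageStandard → SeifertSolPageStandard → CompositePageReduction → _root_.SmoothPoincare4

/-! D-0027 §2.1 — DECIDING THEOREM (planner-authored via `route open/edit --closes-file`; by planner-type-7fdb6c1e92-0 2026-08-17T19:03:45Z):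
its hypotheses are this route's items and its conclusion the sub-problem Statement (glue_lint), and it elaborates with this file. -/

@[closes "route-SmoothPoincare4-FibredPageGeometrization"] theorem closes (hA : Assembly) (h₁ : FibredKnotExists) (h₂ : HyperbolicPageStandard)
    (h₃ : SeifertSolPageStandard) (h₄ : CompositePageReduction) : _root_.SmoothPoincare4 :=
  hA h₁ h₂ h₃ h₄

end Summit.SmoothPoincare4.SmoothPoincare4.Theses.FibredPageGeometrization
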